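import Summits.FinalStateConjecture.FinalStateConjecture.Statement
import Summits.FinalStateConjecture.FinalStateConjecture.Theorems.PhaseMixingCaptureWeakCosmicCensorshipMGHDCompleteNullInfinityInvariant
import Literature.Geometry.Lorentzian.SpacetimePositiveMassRigidity
import Literature.Geometry.Lorentzian.VacuumDataDominantEnergy
import Literature.Geometry.Lorentzian.StronglyAsymptoticallyFlatADMMomentum
import HarnessLib

/-!
# Crux `CensorshipAlongKerrEnds` (stmt-FinalStateConjecture-18521), line `Sketch`:
# stub `stub_nonposMassCensoredOfRigidity` — BASE MASS `≤ 0` FORCES CENSOREDNESS, from the positive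
# mass theorem and its rigidity case

The stub: granted the two named facts `positive_mass_theorem_spacetime` and
`positive_mass_rigidity_spacetime`, an admissible datum `d` (complete, vacuum constraints, one DR-flat
end) which is DR-flat with mass parameter `M ≤ 0` on a SOLE end `e` is CENSORED — every maximal vacuum
Cauchy development of `d` has complete `𝓘⁺` (sojourn form,
`Summit.FinalStateConjecture.HasCompleteNullInfinity`).

Mathematics. (1) The DR mass parameter IS the ADM energy and the ADM momentum vanishes in the DR class
(`AFEnd.IsStronglyAsymptoticallyFlatDR.hasADMEnergy`, `…hasADMMomentum_zero`); admissible data satisfy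
the dominant energy condition with sources decaying at every rate (`VacuumDataDominantEnergy.lean`) and
are asymptotically flat of order `1` (`IsStronglyAsymptoticallyFlatDR.IsAsymptoticallyFlat_one_holds`);
so the spacetime positive mass theorem `|P| ≤ E` (the NAMED FACT `positive_mass_theorem_spacetime`,
Eichmair–Huang–Lee–Schoen 2016, Thm. 1) gives `0 ≤ M`, hence `M = 0` and `E = 0`
(`massParam_nonneg_of_pmt`). (2) The rigid positive energy theorem (the NAMED FACT
`positive_mass_rigidity_spacetime`, Beig–Chruściel 1996, Thm. 4.1, case `m = 0`) then embeds `d` as a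
Cauchy hypersurface of Minkowski space: `∃ 𝒟 : CauchyDevelopment d, 𝒟.toSpacetime = Minkowski.spacetime`
(`exists_cauchyDevelopment_eq_minkowski_of_pmt`). (3) UNCONDITIONALLY, a datum with such a
development is censored (`censored_of_cauchyDevelopment_eq_minkowski`): the development is vacuum
(`Minkowski.isRicciFlat_holds`), it has complete `𝓘⁺` whatever its embedding and normal are, because
`η` is null geodesically complete (`hasCompleteNullInfinity_of_toSpacetime_eq_minkowski`, the pattern of
`minkowski_hasCompleteNullInfinity`), it embeds into every maximal vacuum development by maximality, and
complete `𝓘⁺` ASCENDS along embeddings of Cauchy developments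
(`hasCompleteNullInfinity_of_embedsInto`).

So the registered stub is the composition of (2) and (3) (`stub_nonposMassCensoredOfRigidity`); the two
named facts are undischarged in the tree (D-0014 named facts of `MassInequalities.lean` /
`SpacetimePositiveMassRigidity.lean`) and enter as its hypotheses, exactly as in the sibling crux's
`nonposMassKerrEnded_of_pmt_of_rigidity` (`ExactKerrEndsTameEscapeToKerrEndsNonposMass.lean`).

References: Eichmair–Huang–Lee–Schoen, JEMS 18 (2016), Thm. 1; Beig–Chruściel, J. Math. Phys. 37
(1996), Thm. 4.1; Christodoulou, CQG 16 (1999) A23, pp. A26–A27; Choquet-Bruhat–Geroch, CMP 14 (1969),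
Thm. 3; O'Neill 1983, Ch. 3, Ex. 3.25.
-/

-- the doubled `FinalStateConjecture.FinalStateConjecture` path component trips dupNamespace
set_option linter.dupNamespace false

noncomputable section

open Set Function Filter TopologicalSpace
open scoped Manifold ContDiff Topology

namespace Summit.FinalStateConjecture.FinalStateConjecture.Theorems.ExactKerrEnds.CensorshipAlongKerrEnds

open Literature.Geometry.Lorentzian
open Summit.FinalStateConjecture (HasCompleteNullInfinity)
open Summit.FinalStateConjecture.FinalStateConjecture.Theorems.PhaseMixingCapture.WeakCosmicCensorshipMGHD
  (hasCompleteNullInfinity_of_embedsInto)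

/-! ### Unconditional part: Minkowskian data are censored -/

section Minkowskian

variable {X : Type} [TopologicalSpace X] [ChartedSpace E3 X] [IsManifold (𝓡 3) ∞ X] [ConnectedSpace X]
  {d : InitialDataSet (𝓡 3) X}

/-- **A Cauchy development WHICH IS Minkowski space-time has complete future null infinity**, whatever
its embedding `ι` and normal `ν` (sojourn form): every normalised null ray is a maximal geodesic of `η`,
which is geodesically complete (`Minkowski.isGeodesicallyComplete_smoothMetric`), so by uniqueness of
geodesics (`IsGeodesicOn.eqOn_of_velocity_eq_holds`, the Levi-Civita connection being `C¹`) its affine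
domain is all of `ℝ` (`hasCompleteFutureNullInfinity_of_isNullGeodesicallyComplete`, `B₀ = B₁ = ∅`).
Generalises `minkowski_hasCompleteNullInfinity` (the slice `{t = 0}`) to arbitrary Cauchy hypersurfaces
of Minkowski space. [cite: Christodoulou1999, p. A27] -/
theorem hasCompleteNullInfinity_of_toSpacetime_eq_minkowski (𝒟 : CauchyDevelopment d)
    (h : 𝒟.toSpacetime = Minkowski.spacetime) : HasCompleteNullInfinity 𝒟 := by
  obtain ⟨𝒮, hC⟩ := 𝒟
  obtain ⟨S, ι, hι, ν, hν, hh, hk⟩ := 𝒮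
  dsimp only at h hC
  subst h
  intro _inst
  haveI : Minkowski.smoothMetric.toPseudoRiemannianMetric.HasLeviCivita := _inst
  haveI : CovariantDerivative.ContMDiffCovariantDerivative
      Minkowski.spacetime.metric.toPseudoRiemannianMetric.leviCivita 1 :=
    ⟨Minkowski.spacetime.metric.toPseudoRiemannianMetric.isLocallyContMDiff_leviCivita_holds
      1 (by rw [show ((1 : ℕ∞) : ℕ∞ω) + 1 = 2 by norm_num]; exact WithTop.coe_le_coe.2 le_top)
      univ isOpen_univ⟩
  refine LorentzianMetric.hasCompleteFutureNullInfinity_of_isNullGeodesicallyComplete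
    IsGeodesicOn.eqOn_of_velocity_eq_holds (fun x v _ ↦ ?_) _
  exact Minkowski.isGeodesicallyComplete_smoothMetric x v

/-- **A Cauchy development WHICH IS Minkowski space-time is vacuum** (`Ric(η) = 0`,
`Minkowski.isRicciFlat_holds`). O'Neill 1983, Ch. 3, p. 80. [cite: ONeillSemiRiemannian1983, Ch. 3 p. 80] -/
theorem isRicciFlat_of_toSpacetime_eq_minkowski (𝒟 : CauchyDevelopment d)
    (h : 𝒟.toSpacetime = Minkowski.spacetime) :
    ∀ [𝒟.metric.toPseudoRiemannianMetric.HasLeviCivita],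
      𝒟.metric.toPseudoRiemannianMetric.IsRicciFlat := by
  obtain ⟨𝒮, hC⟩ := 𝒟
  obtain ⟨S, ι, hι, ν, hν, hh, hk⟩ := 𝒮
  dsimp only at h ⊢
  subst h
  exact @Minkowski.isRicciFlat_holds

/-- **A MINKOWSKIAN DATUM IS CENSORED** (unconditionally): if `d` has a Cauchy development `𝒟₁` which
IS Minkowski space-time (e.g. the conclusion of `positive_mass_rigidity_spacetime`), then EVERY maximal
vacuum Cauchy development `𝒟` of `d` has complete `𝓘⁺`. `𝒟₁` is vacuum
(`isRicciFlat_of_toSpacetime_eq_minkowski`), so as a vacuum Cauchy development `⟨𝒟₁, _⟩` it embeds into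
`𝒟` by maximality; it has complete `𝓘⁺` (`hasCompleteNullInfinity_of_toSpacetime_eq_minkowski`); and
complete `𝓘⁺` ascends along embeddings of Cauchy developments (`hasCompleteNullInfinity_of_embedsInto`).
Generalises `censored_trivialData`.
[cite: Christodoulou1999, pp. A26–A27] [cite: ChoquetBruhatGeroch1969CMP, Thm. 3] -/
theorem censored_of_cauchyDevelopment_eq_minkowski (𝒟₁ : CauchyDevelopment d)
    (h : 𝒟₁.toSpacetime = Minkowski.spacetime) :
    ∀ 𝒟 : VacuumCauchyDevelopment d, 𝒟.IsMaximal → HasCompleteNullInfinity 𝒟.toCauchyDevelopment :=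
  -- explicit `@`: `HasCompleteNullInfinity 𝒟₁` unfolds to `∀ [g.HasLeviCivita], …`, and a non-explicit
  -- application of this type would be auto-applied to a (non-synthesisable) Levi-Civita instance
  fun 𝒟 h𝒟 ↦ hasCompleteNullInfinity_of_embedsInto 𝒟₁ 𝒟.toCauchyDevelopment
    (h𝒟 ⟨𝒟₁, isRicciFlat_of_toSpacetime_eq_minkowski 𝒟₁ h⟩)
    (@hasCompleteNullInfinity_of_toSpacetime_eq_minkowski X _ _ _ _ d 𝒟₁ h)

end Minkowskian

/-! ### The positive mass theorem on the admissible class -/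

section PMT

variable {X : Type} [TopologicalSpace X] [ChartedSpace E3 X] [IsManifold (𝓡 3) ∞ X] [T2Space X]
  [SecondCountableTopology X] [ConnectedSpace X] {d : InitialDataSet (𝓡 3) X} {e : AFEnd X} {M : ℝ}

/-- **The DR mass parameter of an admissible datum on a sole end is non-negative**, granted the spacetime
positive mass theorem `positive_mass_theorem_spacetime` (EHLS 2016, Thm. 1): admissible data satisfy the
dominant energy condition (`satisfiesDominantEnergyCondition_of_mem_admissibleVacuumData`) with source
decay of every rate (`hasSourceDecay_of_mem_admissibleVacuumData`), are complete and asymptotically flat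
of order `1` on the end (`IsStronglyAsymptoticallyFlatDR.IsAsymptoticallyFlat_one_holds`), their ADM
energy flux converges to `M` (`IsStronglyAsymptoticallyFlatDR.hasADMEnergy`, `admEnergy_eq`) and their
ADM momentum fluxes to `0` (`hasADMMomentum_zero`); so `0 ≤ |P| ≤ E = M`.
[cite: EichmairHuangLeeSchoen2016, Thm. 1] [cite: DafermosRodnianski2013, App. B.2.3] -/
theorem massParam_nonneg_of_pmt (hpmt : positive_mass_theorem_spacetime)
    (hd : d ∈ admissibleVacuumData X) (hsole : e.IsSoleEnd)
    (hDR : e.IsStronglyAsymptoticallyFlatDR d M) : 0 ≤ M := by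
  haveI := d.metric.hasLeviCivita
  have hineq := hpmt X d e (satisfiesDominantEnergyCondition_of_mem_admissibleVacuumData hd)
    (AFEnd.IsStronglyAsymptoticallyFlatDR.IsAsymptoticallyFlat_one_holds e d hDR)
    ⟨1, hasSourceDecay_of_mem_admissibleVacuumData e hd one_pos⟩ hsole
    (isComplete_of_mem_admissibleVacuumData hd) ⟨M, hDR.hasADMEnergy⟩
    (fun i ↦ ⟨0, hDR.hasADMMomentum_zero i⟩)
  rw [hDR.admEnergy_eq] at hineq
  exact (Real.sqrt_nonneg _).trans hineq

/-- **An admissible datum with DR mass parameter `M ≤ 0` on a sole end is a Cauchy hypersurface of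
Minkowski space-time**, granted the spacetime positive mass theorem (`positive_mass_theorem_spacetime`,
EHLS 2016, Thm. 1: forces `M = 0`, `massParam_nonneg_of_pmt`, so the ADM energy flux converges to `0`)
and its rigidity case (`positive_mass_rigidity_spacetime`, Beig–Chruściel 1996, Thm. 4.1, `m = 0`).
[cite: BeigChrusciel1996, Thm. 4.1 (§4), case m = 0] [cite: EichmairHuangLeeSchoen2016, Thm. 1] -/
theorem exists_cauchyDevelopment_eq_minkowski_of_pmt (hpmt : positive_mass_theorem_spacetime)
    (hrig : positive_mass_rigidity_spacetime) (hd : d ∈ admissibleVacuumData X) (hsole : e.IsSoleEnd)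
    (hM : M ≤ 0) (hDR : e.IsStronglyAsymptoticallyFlatDR d M) :
    ∃ 𝒟 : CauchyDevelopment d, 𝒟.toSpacetime = Minkowski.spacetime := by
  haveI := d.metric.hasLeviCivita
  have hM0 : M = 0 := le_antisymm hM (massParam_nonneg_of_pmt hpmt hd hsole hDR)
  subst hM0
  exact hrig X d e (satisfiesDominantEnergyCondition_of_mem_admissibleVacuumData hd)
    (AFEnd.IsStronglyAsymptoticallyFlatDR.IsAsymptoticallyFlat_one_holds e d hDR)
    ⟨1, hasSourceDecay_of_mem_admissibleVacuumData e hd one_pos⟩ hsole hDR.hasADMEnergy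

end PMT

/-! ### The stub from the two named facts -/

/-- **Stub `stub_nonposMassCensoredOfRigidity` — BASE MASS `≤ 0` FORCES CENSOREDNESS, FROM THE POSITIVE
MASS THEOREM AND ITS RIGIDITY CASE**: granted `positive_mass_theorem_spacetime` (EHLS 2016, Thm. 1) and
`positive_mass_rigidity_spacetime` (Beig–Chruściel 1996, Thm. 4.1), an admissible datum which is DR-flat
with mass parameter `M ≤ 0` on a sole end is a Cauchy hypersurface of Minkowski space-time
(`exists_cauchyDevelopment_eq_minkowski_of_pmt`), hence censored
(`censored_of_cauchyDevelopment_eq_minkowski`). VERBATIM the registered signature of the stub.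
[cite: BeigChrusciel1996, Thm. 4.1 (§4), case m = 0] [cite: Christodoulou1999, pp. A26–A27] -/
theorem stub_nonposMassCensoredOfRigidity : Literature.Geometry.Lorentzian.positive_mass_theorem_spacetime → Literature.Geometry.Lorentzian.positive_mass_rigidity_spacetime → ∀ (X : Type) [TopologicalSpace X] [ChartedSpace Literature.Geometry.Lorentzian.E3 X] [IsManifold (𝓡 3) ((⊤ : ℕ∞) : WithTop ℕ∞) X] [T2Space X] [SecondCountableTopology X] [ConnectedSpace X], ∀ d ∈ Literature.Geometry.Lorentzian.admissibleVacuumData X, ∀ (e : Literature.Geometry.Lorentzian.AFEnd X) (M : ℝ), e.IsSoleEnd → M ≤ 0 → e.IsStronglyAsymptoticallyFlatDR d M → ∀ 𝒟 : Literature.Geometry.Lorentzian.VacuumCauchyDevelopment d, 𝒟.IsMaximal → Summit.FinalStateConjecture.HasCompleteNullInfinity 𝒟.toCauchyDevelopment := by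
  intro hpmt hrig X _ _ _ _ _ _ d hd e M hsole hM hDR
  obtain ⟨𝒟₁, h𝒟₁⟩ := exists_cauchyDevelopment_eq_minkowski_of_pmt hpmt hrig hd hsole hM hDR
  exact censored_of_cauchyDevelopment_eq_minkowski 𝒟₁ h𝒟₁

end Summit.FinalStateConjecture.FinalStateConjecture.Theorems.ExactKerrEnds.CensorshipAlongKerrEnds

end
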